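import Mathlib
import HarnessLib
import Literature.Combinatorics.Additive.QuasiPeriodicDecompositions
import Literature.Combinatorics.Additive.HamidouneCriticalPairAbelian

/-!
# Grynkiewicz 2009, «A step beyond Kemperman's structure theorem»: `d`-components,
# quasi-progressions, the distance `d⊆(A, 𝒮)`, and Lemma 5.8 (an arithmetic-progression summand
# of a pair with `|A + B| = |A| + |B|` forces a one-hole quasi-progression)

Topic `Literature/Combinatorics/Additive`.  Cell `mm-stpp` (D-0046), seat `mm-stpp-lit` (gen 21);
third file of the port of

* D. J. Grynkiewicz, *A step beyond Kemperman's structure theorem*, Mathematika **55** (2009)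
  67–114, doi 10.1112/S0025579300000966 [Grynkiewicz2009] — held as
  `paper:doi-10-1112-s0025579300000966` (version of record; theorem numbering below is the PRINT
  numbering) and as arXiv:0710.1041v2 (`paper:arxiv-0710.1041`; print §5 = arXiv §4, print
  Lemma 5.8 = arXiv Lemma 4.12),

after `SumsetVersusDifferenceSet.lean` (Theorem 3.1) and `QuasiPeriodicDecompositions.lean` (the
§2 vocabulary `IsPeriodicWith`, `IsQuasiPeriodicDecomp`, `IsQuasiPeriodic`, `IsNonExtendible`,
Propositions 2.1/2.2/2.4, Lemmas 5.1–5.4, Proposition 5.5).  Everything here is PROVED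
(0 `sorry`, 0 named facts); the two `def`s with a `Prop` body are predicates with arguments
(definitions), not closed statements.

## What is formalized (read at the page this session: print pp. 1, 3–4, 20; arXiv p. 4, 18)

§2 (print p. 3): "A `d`-component of a set `A` is a maximal arithmetic progression with difference
`d` contained in `A`.  We use `c_d(A)` to denote the number of aperiodic `d`-components of `A`.  Note
that if a `d`-component is periodic, then it must be a `⟨d⟩`-coset.  Hence `c_d(A) = |A + {0, d}| − |A|`.
If `c_d(A) = 1`, then `A` is a *quasi-progression* with difference `d`."  §1 (print p. 1): "For a
set `𝒮` of subsets of `G`, define `d⊆(A, 𝒮) = min_{B ∈ 𝒮} d⊆(A, B)`, where `d⊆(A, B) = |B ∖ A|` if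
`A ⊆ B`, and `d⊆(A, B) = ∞` otherwise."  §2 (print p. 4): "let `QAP_d` be the set of
quasi-progressions with difference `d`."

* `componentCount d A` **is** `c_d(A) := |A + {0, d}| − |A|` [cite: Grynkiewicz2009, §2]; it equals
  the run-end count `|(d + A) ∖ A|` of the tree (`Isoperimetric.card_add_pair_zero_eq`,
  [Hamidoune2000, Lemma 6.1] as `Isoperimetric.eq_filter_union_biUnion_apFinset`):
  `componentCount_eq_card_vadd_sdiff`.  API: `card_add_pair_zero` (`|A + {0,d}| = |A| + c_d(A)`),
  `componentCount_zero_left`, `componentCount_add_pair_zero_le` (`c_d(A + {0,d}) ≤ c_d(A)`: adding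
  `{0, d}` lengthens every aperiodic component by one and can only merge components),
  `componentCount_eq_zero_iff` (`c_d(A) = 0 ↔ d + A = A`), `componentCount_vadd`,
  `componentCount_neg_left`, `componentCount_neg`, `componentCount_compl` (finite `G`:
  `c_d(G ∖ A) = c_d(A)`), the telescoping count
  `card_add_apFinset_zero_eq : |B + {0, d, …, m d}| = |B| + Σ_{j<m} c_d(B + {0, d, …, j d})`,
  and the two local moves of the proof of Lemma 5.8: `exists_gap_one` (`c_d(B) = 2`,
  `c_d(B + {0,d}) = 1` ⇒ some hole `β ∉ B` has both neighbours `β ± d ∈ B`) and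
  `componentCount_insert_add_one` (filling such a hole merges two components).
* `IsQuasiProgression d P` **is** the printed definition `c_d(P) = 1` [cite: Grynkiewicz2009, §2].
  The arXiv wording (v2, §2: "a set `P` with a quasi-periodic decomposition `P = P₁ ∪ P₀` with
  quasi-period `⟨d⟩`, such that `P₀` is an arithmetic progression with difference `d`") is RECOVERED,
  for finite `G`, as `IsQuasiProgression.exists_isQuasiPeriodicDecomp` (via Hamidoune's Lemma 6.1
  with one run-end, `Isoperimetric.exists_eq_filter_union_apFinset_of_card_vadd_sdiff_eq_one`), in the
  tree's vocabulary `IsQuasiPeriodicDecomp (AddSubgroup.zmultiples d) P P₁ P₀ ∧ IsAP P₀ d ∧ P₀ ≠ ∅`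
  (`IsAP`, `apFinset` from `Vosper.lean`).  API: `IsQuasiProgression.ne_zero`,
  `isQuasiProgression_vadd_iff`, `isQuasiProgression_neg_iff`, `isQuasiProgression_compl_iff`,
  `isQuasiProgression_apFinset` (a genuine progression that does not fill its `⟨d⟩`-coset is one),
  `isPeriodicWith_zmultiples_of_vadd_eq`.
* `subsetDist A 𝒮 : ℕ∞` **is** `d⊆(A, 𝒮)` [cite: Grynkiewicz2009, §1]: the infimum over `B ∈ 𝒮`
  with `A ⊆ B` of `|B ∖ A|` (an empty infimum is `⊤ = ∞`, which is the printed "`d⊆(A, B) = ∞`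
  otherwise" and the printed minimum over an empty family).  API: `subsetDist_le`, `le_subsetDist`,
  `le_subsetDist_iff`, `subsetDist_anti` (antitone in the family), `subsetDist_eq_zero_iff`
  (`= 0 ↔ A ∈ 𝒮`), `subsetDist_eq_one`, `subsetDist_eq_top`.
* `IsPeriodic A` **is** "periodic" (`H`-periodic for some nontrivial `H`) [cite: Grynkiewicz2009, §2];
  `isPeriodic_iff_addStab_ne` (nonempty `A`: `↔ A.addStab ≠ {0}`, the tree's «aperiodic» being
  `addStab = {0}`), `IsPeriodic.isQuasiPeriodic` ("`P ⊆ QP`", nonempty sets), `IsPeriodic.vadd`,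
  `subsetDist_isQuasiPeriodic_le` (`d⊆(A, QP) ≤ d⊆(A, P)`), and for the family `P_H` of `H`-periodic
  sets (`{P | IsPeriodicWith H P}`, `H` carried as a finset `Hf` with `∀ g, g ∈ Hf ↔ g ∈ H`):
  `isPeriodicWith_iff_add_eq` (`↔ A + H = A`), `isPeriodicWith_add_of_forall_mem_iff`,
  **`subsetDist_isPeriodicWith : d⊆(A, P_H) = |A + H| − |A|`** (the number of `H`-holes, print p. 3).
  The converse quasi-progression bridge `isQuasiProgression_union_apFinset` (arXiv wording ⇒
  `c_d = 1`).  Two printed remarks of §2 (print p. 3): `not_isPeriodic_of_isPeriodicWith_insert`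
  («a punctured periodic set cannot be periodic», via `eq_zero_of_vadd_eq_of_isPeriodicWith_insert`) and
  `card_add_card_le_card_add_succ_of_lone_coset` («if either `A` or `B` contains a unique element from
  some `H(A+B)`-coset, then `|A + B| ≥ |A| + |B| − 1`», from `add_kneser`).
* **Lemma 5.8** [cite: Grynkiewicz2009, Lemma 5.8] (print p. 20; arXiv Lemma 4.12 with
  `h_d(B) = 1`, `h_d(A+B) = h_d(overline{A+B}) = 0`): "Let `A` and `B` be finite, nonempty subsets
  of an abelian group `G` with `|A + B| = |A| + |B|`, `|A| ≥ 3`, and `A + B` aperiodic.  If `A` is an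
  arithmetic progression with difference `d`, then `d⊆(B, QAP_d) = 1`,
  `d⊆(A + B, QAP_d) = d⊆(overline{A + B}, QAP_d) = 0` and (17) holds", where (17) (print p. 10) is
  "`|(A ∪ {α}) + (B ∪ {β})| = |A ∪ {α}| + |B ∪ {β}| − 1` for some `α, β ∈ G`" —
  `Grynkiewicz2009.subsetDist_quasiProgression_of_isAP` (the three conclusions about `B`, `A + B`
  and (17), any abelian `G`) and `Grynkiewicz2009.subsetDist_quasiProgression_compl_of_isAP` (the
  conclusion about `overline{A + B} = G ∖ (A + B)`, finite `G`), on top of the quantitative core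
  `Grynkiewicz2009.componentCount_of_isAP : c_d(B) = 2 ∧ c_d(B + {0,d}) = 1 ∧ c_d(A + B) = 1`.
  PROOF AS PRINTED ("`|A + B| ≥ |B| + c(|A| − 1)`, where `c` is the number of `d`-components of
  `overline{B}` with length at least `|A| − 1` … either `|A + B| ≥ |B| + 2(|A| − 1)` or else
  `|A + B| = |B| + |A| − 1 + d⊆(B, QAP_d)`"), organised along the chain
  `X_j = B + {0, d, …, j d}` (`A + B = a₀ + X_{l−1}`, `l = |A|`): `|A + B| = |B| + Σ_{j<l−1} c_d(X_j)`
  (`card_add_apFinset_zero_eq`) with `c_d(X_j)` non-increasing (`componentCount_add_pair_zero_le`)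
  and `≥ 1` for `j ≤ l − 1` (else `X_j`, hence `A + B`, is `d`-invariant: `componentCount_eq_zero_iff`),
  so that `Σ_{j<l−1} c_d(X_j) = l` with `l − 1 ≥ 2` terms forces `c_d(X_0) = 2`,
  `c_d(X_j) = 1 (1 ≤ j ≤ l − 1)` (`antitone_sum_eq`; `c_d(X_{l−2})` is the printed `c`, the number of
  gaps of `B` of length `≥ l − 1`, and `c ≥ 2` is the printed "`|A + B| ≥ |B| + 2(|A| − 1)`");
  then `c_d(B) = 2`, `c_d(B + {0,d}) = 1` give the single short hole `β` (`exists_gap_one`),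
  `B ∪ {β} ∈ QAP_d` (`componentCount_insert_add_one`), `B ∉ QAP_d`, `A + B ∈ QAP_d`,
  `overline{A + B} ∈ QAP_d` (`componentCount_compl`), and (17) with `α = a₀ ∈ A` and this `β`
  (`apFinset_add_insert_eq : A + (B ∪ {β}) = A + B`).

## Deviations from print

* Lemma 5.8 is printed for "an abelian group `G`"; the clause about the complement
  `overline{A + B} = G ∖ (A + B)` is only meaningful for finite `G` (where §6 applies the lemma:
  "The case when `G` is infinite is then derived from the finite case", print p. 23) and is stated
  under `[Fintype G]`; the other three conclusions are proved for every abelian group.  The printed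
  hypothesis "`B` nonempty" is implied by `|A + B| = |A| + |B|`, `|A| ≥ 3` and dropped.
  `-- TODO(general form): none needed beyond this.`
* «Aperiodic» is spelled, as in `QuasiPeriodicDecompositions.lean` / `KempermanStructureTheorem.lean`,
  `(A + B).addStab = {0}`; «`A` is an arithmetic progression with difference `d`» is the tree's
  `IsAP A d` (`A = {a, a + d, …, a + (|A| − 1) d}` with `|A|` distinct terms, `Vosper.lean`), which
  for `|A| ≥ 2` forces `d ≠ 0` (`IsAP.ne_zero`), as in print ("difference `d ∈ G ∖ 0`").
* (17) is rendered in `ℕ` as `|(A ∪ {α}) + (B ∪ {β})| + 1 = |A ∪ {α}| + |B ∪ {β}|`.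
* `quasi-progression`: the print definition `c_d(P) = 1` is taken as primary (it excludes
  `⟨d⟩`-periodic sets, for which `c_d = 0`); the arXiv structural wording is a proved consequence
  (finite `G`), see above.  The arXiv quantities `l_d`, `h_d` are not introduced (print replaced
  them by `d⊆(·, QAP_d)`).
Census-silent Literature shelf: no row, bracket, threshold or verdict word of the cell moves; no `ω`.
-/

namespace Literature.Combinatorics.Additive

open Finset
open scoped Pointwise

variable {G : Type*} [AddCommGroup G] [DecidableEq G]

/-! ### `c_d(A)`: the number of aperiodic `d`-components -/

/-- **`c_d(A)`, the number of aperiodic `d`-components of `A`.**  Print: "A `d`-component of a set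
`A` is a maximal arithmetic progression with difference `d` contained in `A`.  We use `c_d(A)` to
denote the number of aperiodic `d`-components of `A` … Hence `c_d(A) = |A + {0, d}| − |A|`"; the
last identity is taken as the definition. [cite: Grynkiewicz2009, §2] -/
def componentCount (d : G) (A : Finset G) : ℕ := #(A + {0, d}) - #A

/-- `A + {0, d} = A ∪ (d + A)`. [cite: Grynkiewicz2009, §2 (c_d(A) = |A + {0,d}| − |A|)] -/
theorem add_pair_zero_eq_union (A : Finset G) (d : G) : A + {0, d} = A ∪ (d +ᵥ A) := by
  ext x
  simp only [mem_add, mem_insert, mem_singleton, mem_union, mem_vadd_finset, vadd_eq_add]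
  constructor
  · rintro ⟨a, ha, b, hb, rfl⟩
    rcases hb with hb | hb
    · left
      rwa [hb, add_zero]
    · right
      exact ⟨a, ha, by rw [hb, add_comm]⟩
  · rintro (hx | ⟨a, ha, rfl⟩)
    · exact ⟨x, hx, 0, Or.inl rfl, add_zero x⟩
    · exact ⟨a, ha, d, Or.inr rfl, add_comm a d⟩

/-- `c_d(A) = |(d + A) ∖ A|`, the number of run-ends of `A` in direction `d` (the tree's count in
`Isoperimetric.card_add_pair_zero_eq`, [Hamidoune2000, Lemma 6.1]: "`j = |{0,d} + B| − |B|`"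
progressions). [cite: Grynkiewicz2009, §2 (c_d(A) = |A + {0,d}| − |A|)] -/
theorem componentCount_eq_card_vadd_sdiff (d : G) (A : Finset G) :
    componentCount d A = #((d +ᵥ A) \ A) := by
  unfold componentCount
  rw [Isoperimetric.card_add_pair_zero_eq]
  omega

/-- `|A + {0, d}| = |A| + c_d(A)`. [cite: Grynkiewicz2009, §2] -/
theorem card_add_pair_zero (d : G) (A : Finset G) :
    #(A + {0, d}) = #A + componentCount d A := by
  rw [componentCount_eq_card_vadd_sdiff, Isoperimetric.card_add_pair_zero_eq]

/-- `c_0(A) = 0` (the printed `d` is non-zero; recorded for completeness).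
[cite: Grynkiewicz2009, §2] -/
theorem componentCount_zero_left (A : Finset G) : componentCount (0 : G) A = 0 := by
  rw [componentCount_eq_card_vadd_sdiff, zero_vadd, Finset.sdiff_self, card_empty]

/-- **Adding `{0, d}` does not increase the number of aperiodic `d`-components**: every component
grows by one term into the following gap, and components merge when a gap closes, so
`c_d(A + {0, d}) ≤ c_d(A)` (the monotonicity behind "`|A + B| ≥ |B| + c(|A| − 1)`" in the proof of
Lemma 5.8). [cite: Grynkiewicz2009, Lemma 5.8 (proof)] -/
theorem componentCount_add_pair_zero_le (d : G) (A : Finset G) :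
    componentCount d (A + {0, d}) ≤ componentCount d A := by
  rw [componentCount_eq_card_vadd_sdiff, componentCount_eq_card_vadd_sdiff, add_pair_zero_eq_union,
    ← card_vadd_finset d ((d +ᵥ A) \ A)]
  refine card_le_card fun x hx => ?_
  rw [mem_sdiff] at hx
  obtain ⟨hx1, hx2⟩ := hx
  obtain ⟨y, hy, rfl⟩ := mem_vadd_finset.1 hx1
  have hyA : y ∉ A := fun hyA => hx2 (mem_union_right _ (vadd_mem_vadd_finset hyA))
  rw [mem_union] at hy
  exact mem_vadd_finset.2 ⟨y, mem_sdiff.2 ⟨hy.resolve_left hyA, hyA⟩, rfl⟩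

/-- `c_d(A) = 0` iff `A` is `d`-invariant (all `d`-components are `⟨d⟩`-cosets: "if a `d`-component
is periodic, then it must be a `⟨d⟩`-coset"). [cite: Grynkiewicz2009, §2] -/
theorem componentCount_eq_zero_iff {d : G} {A : Finset G} :
    componentCount d A = 0 ↔ d +ᵥ A = A := by
  rw [componentCount_eq_card_vadd_sdiff, card_eq_zero, sdiff_eq_empty_iff_subset]
  constructor
  · intro h
    exact eq_of_subset_of_card_le h (by rw [card_vadd_finset])
  · intro h
    rw [h]

/-- `c_d` is translation invariant. [cite: Grynkiewicz2009, §2] -/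
theorem componentCount_vadd (d a : G) (A : Finset G) :
    componentCount d (a +ᵥ A) = componentCount d A := by
  rw [componentCount_eq_card_vadd_sdiff, componentCount_eq_card_vadd_sdiff, vadd_vadd, add_comm,
    ← vadd_vadd, ← vadd_finset_sdiff, card_vadd_finset]

/-- `−((d + (−A)) ∖ (−A)) = (−d + A) ∖ A`. [cite: Grynkiewicz2009, §2 (an arithmetic progression
with difference d is also one with difference −d)] -/
theorem neg_sdiff_vadd_neg (d : G) (A : Finset G) : -((d +ᵥ -A) \ -A) = (-d +ᵥ A) \ A := by
  ext x
  rw [mem_neg', mem_sdiff, mem_sdiff, mem_neg', neg_neg, mem_vadd_finset, mem_vadd_finset]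
  constructor
  · rintro ⟨⟨z, hz, hzx⟩, hxA⟩
    rw [mem_neg'] at hz
    refine ⟨⟨-z, hz, ?_⟩, hxA⟩
    rw [vadd_eq_add, ← neg_add, ← vadd_eq_add, hzx, neg_neg]
  · rintro ⟨⟨y, hy, rfl⟩, hxA⟩
    refine ⟨⟨-y, by rwa [mem_neg', neg_neg], ?_⟩, hxA⟩
    rw [vadd_eq_add, vadd_eq_add, neg_add, neg_neg]

/-- `c_{−d}(A) = c_d(A)` ("an arithmetic progression with difference `d` is also an arithmetic
progression with difference `−d`"). [cite: Grynkiewicz2009, §2] -/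
theorem componentCount_neg_left (d : G) (A : Finset G) :
    componentCount (-d) A = componentCount d A := by
  rw [componentCount_eq_card_vadd_sdiff, componentCount_eq_card_vadd_sdiff]
  have : (-d +ᵥ A) \ A = -d +ᵥ (A \ (d +ᵥ A)) := by
    rw [vadd_finset_sdiff, neg_vadd_vadd]
  rw [this, card_vadd_finset]
  exact card_sdiff_comm (card_vadd_finset d A).symm

/-- `c_d(−A) = c_d(A)`. [cite: Grynkiewicz2009, §2] -/
theorem componentCount_neg (d : G) (A : Finset G) :
    componentCount d (-A) = componentCount d A := by
  rw [← componentCount_neg_left d A, componentCount_eq_card_vadd_sdiff,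
    componentCount_eq_card_vadd_sdiff, ← neg_sdiff_vadd_neg, card_neg]

/-- In a finite group `c_d(G ∖ A) = c_d(A)`: the aperiodic `d`-components of the complement are the
gaps between those of `A` (used in Lemma 5.8 for `overline{A + B}` and in Lemma 5.9 as
"`c_d(A) = c_d(overline{A}) = 2`"). [cite: Grynkiewicz2009, Lemma 5.8 (proof, "whence
h_d(overline{A+B}) = 0 as well")] -/
theorem componentCount_compl [Fintype G] (d : G) (A : Finset G) :
    componentCount d Aᶜ = componentCount d A := by
  rw [componentCount_eq_card_vadd_sdiff, componentCount_eq_card_vadd_sdiff]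
  have h1 : d +ᵥ Aᶜ = (d +ᵥ A)ᶜ := by
    ext x
    constructor
    · intro hx
      obtain ⟨y, hy, rfl⟩ := mem_vadd_finset.1 hx
      rw [mem_compl] at hy ⊢
      exact fun h => hy ((vadd_mem_vadd_finset_iff d).1 h)
    · intro hx
      rw [mem_compl] at hx
      refine mem_vadd_finset.2 ⟨-d +ᵥ x, ?_, vadd_neg_vadd d x⟩
      rw [mem_compl]
      intro h
      exact hx (by have := vadd_mem_vadd_finset (a := d) h; rwa [vadd_neg_vadd] at this)
  rw [h1, compl_sdiff_compl]
  exact card_sdiff_comm (card_vadd_finset d A).symm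

/-- A `d`-invariant set absorbs `{0, d}`. [cite: Grynkiewicz2009, §2] -/
theorem add_pair_zero_eq_self_of_vadd_eq {d : G} {A : Finset G} (h : d +ᵥ A = A) :
    A + {0, d} = A := by
  rw [add_pair_zero_eq_union, h, union_idempotent]

/-- `{0, d, …, (j+1) d} = {0, d, …, j d} + {0, d}`. [cite: Grynkiewicz2009, Lemma 5.8 (proof)] -/
theorem apFinset_zero_succ_succ (d : G) (j : ℕ) :
    apFinset (0 : G) d (j + 2) = apFinset 0 d (j + 1) + {0, d} := by
  rw [add_pair_zero_eq_union, apFinset_succ_eq_union 0 d (Nat.succ_pos j)]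

/-- The chain `X_{j+1} = X_j + {0, d}` for `X_j = B + {0, d, …, j d}`.
[cite: Grynkiewicz2009, Lemma 5.8 (proof)] -/
theorem add_apFinset_zero_succ_succ (B : Finset G) (d : G) (j : ℕ) :
    B + apFinset (0 : G) d (j + 2) = (B + apFinset 0 d (j + 1)) + {0, d} := by
  rw [apFinset_zero_succ_succ, add_assoc]

/-- `X_0 = B + {0} = B`. [cite: Grynkiewicz2009, Lemma 5.8 (proof)] -/
theorem add_apFinset_zero_one (B : Finset G) (d : G) : B + apFinset (0 : G) d 1 = B := by
  rw [apFinset_one, Finset.singleton_zero, add_zero]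

/-- **Telescoping count along an arithmetic progression**:
`|B + {0, d, …, m d}| = |B| + Σ_{j<m} c_d(B + {0, d, …, j d})` (the quantitative form of
"`|A + B| ≥ |B| + c(|A| − 1)`"). [cite: Grynkiewicz2009, Lemma 5.8 (proof)] -/
theorem card_add_apFinset_zero_eq (B : Finset G) (d : G) (m : ℕ) :
    #(B + apFinset (0 : G) d (m + 1)) =
      #B + ∑ j ∈ range m, componentCount d (B + apFinset 0 d (j + 1)) := by
  induction m with
  | zero => rw [add_apFinset_zero_one, sum_range_zero, add_zero]
  | succ m ih => rw [add_apFinset_zero_succ_succ, card_add_pair_zero, ih, sum_range_succ, add_assoc]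

/-- **A gap of length one.**  If `B` has two aperiodic `d`-components but `B + {0, d}` only one,
then one of the two gaps of `B` closes after one step: some hole `β ∉ B` has `β − d, β + d ∈ B`
("else `|A + B| = |B| + |A| − 1 + d⊆(B, QAP_d)` … `d⊆(B, QAP_d) = 1`").
[cite: Grynkiewicz2009, Lemma 5.8 (proof)] -/
theorem exists_gap_one {B : Finset G} {d : G} (h2 : componentCount d B = 2)
    (h1 : componentCount d (B + {0, d}) = 1) : ∃ β, β ∉ B ∧ β - d ∈ B ∧ β + d ∈ B := by
  rw [componentCount_eq_card_vadd_sdiff] at h1 h2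
  by_contra hne
  push Not at hne
  have hsub : d +ᵥ ((d +ᵥ B) \ B) ⊆ (d +ᵥ (B + {0, d})) \ (B + {0, d}) := by
    intro x hx
    obtain ⟨e, he, rfl⟩ := mem_vadd_finset.1 hx
    rw [mem_sdiff] at he
    obtain ⟨he1, he2⟩ := he
    obtain ⟨b, hb, rfl⟩ := mem_vadd_finset.1 he1
    have hplus : (d +ᵥ b) + d ∉ B :=
      hne _ he2 (by rw [vadd_eq_add, add_sub_cancel_left]; exact hb)
    rw [add_pair_zero_eq_union, mem_sdiff, mem_union, not_or]
    refine ⟨vadd_mem_vadd_finset (mem_union_right _ he1), ?_, ?_⟩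
    · rwa [vadd_eq_add, add_comm]
    · intro h
      exact he2 ((vadd_mem_vadd_finset_iff d).1 h)
  have := card_le_card hsub
  rw [card_vadd_finset] at this
  omega

/-- **Filling a hole of length one merges two components**: if `β ∉ B` and `β − d, β + d ∈ B`, then
`c_d(B ∪ {β}) + 1 = c_d(B)`. [cite: Grynkiewicz2009, Lemma 5.8 (proof, "letting β be the single
hole in B")] -/
theorem componentCount_insert_add_one {B : Finset G} {d β : G} (hβ : β ∉ B) (h1 : β - d ∈ B)
    (h2 : β + d ∈ B) : componentCount d (insert β B) + 1 = componentCount d B := by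
  rw [componentCount_eq_card_vadd_sdiff, componentCount_eq_card_vadd_sdiff, vadd_finset_insert]
  have hdb : d +ᵥ β ∈ insert β B := mem_insert_of_mem (by rwa [vadd_eq_add, add_comm])
  rw [insert_sdiff_of_mem _ hdb, sdiff_insert]
  have hβD : β ∈ (d +ᵥ B) \ B :=
    mem_sdiff.2 ⟨mem_vadd_finset.2 ⟨β - d, h1, by rw [vadd_eq_add, add_sub_cancel]⟩, hβ⟩
  rw [card_erase_of_mem hβD]
  have : 1 ≤ #((d +ᵥ B) \ B) := card_pos.2 ⟨β, hβD⟩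
  omega

/-- If `β − d, β + d ∈ B`, a progression `{a₀, …, a₀ + (l−1) d}` with `l ≥ 2` terms does not see
the hole: `A + (B ∪ {β}) = A + B` (the count behind (17) in Lemma 5.8: "letting `β` be the single
hole in `B` and letting `α ∈ A`, it follows that (17) holds"). [cite: Grynkiewicz2009, Lemma 5.8
(proof)] -/
theorem apFinset_add_insert_eq {B : Finset G} {a₀ d β : G} {l : ℕ} (hl : 2 ≤ l) (h1 : β - d ∈ B)
    (h2 : β + d ∈ B) : apFinset a₀ d l + insert β B = apFinset a₀ d l + B := by
  refine Subset.antisymm ?_ (add_subset_add_left (subset_insert β B))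
  intro x hx
  obtain ⟨y, hy, z, hz, rfl⟩ := mem_add.1 hx
  rw [mem_insert] at hz
  rcases hz with hz | hz
  · rw [hz]
    rw [mem_apFinset] at hy
    obtain ⟨i, hi, rfl⟩ := hy
    by_cases hil : i + 1 < l
    · refine mem_add.2 ⟨a₀ + (i + 1) • d, mem_apFinset.2 ⟨i + 1, hil, rfl⟩, β - d, h1, ?_⟩
      rw [succ_nsmul]
      abel
    · obtain ⟨k, rfl⟩ : ∃ k, i = k + 1 := ⟨i - 1, by omega⟩
      refine mem_add.2 ⟨a₀ + k • d, mem_apFinset.2 ⟨k, by omega, rfl⟩, β + d, h2, ?_⟩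
      rw [succ_nsmul]
      abel
  · exact mem_add.2 ⟨y, hy, z, hz, rfl⟩

/-! ### Quasi-progressions with difference `d` (`QAP_d`) -/

/-- **Quasi-progression with difference `d`.**  Print: "If `c_d(A) = 1`, then `A` is a
*quasi-progression* with difference `d`", i.e. `A` has exactly one aperiodic `d`-component (all
other `d`-components being `⟨d⟩`-cosets); arXiv v2 §2 words it as "a set `P` with a quasi-periodic
decomposition `P = P₁ ∪ P₀` with quasi-period `⟨d⟩`, such that `P₀` is an arithmetic progression
with difference `d`" — see `IsQuasiProgression.exists_isQuasiPeriodicDecomp`.  `⟨d⟩`-periodic sets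
(`c_d = 0`) are not quasi-progressions in the printed sense. [cite: Grynkiewicz2009, §2] -/
def IsQuasiProgression (d : G) (P : Finset G) : Prop := componentCount d P = 1

/-- The difference of a quasi-progression is non-zero. [cite: Grynkiewicz2009, §2 (difference
d ∈ G ∖ 0)] -/
theorem IsQuasiProgression.ne_zero {d : G} {P : Finset G} (h : IsQuasiProgression d P) : d ≠ 0 := by
  rintro rfl
  rw [IsQuasiProgression, componentCount_zero_left] at h
  exact zero_ne_one h

/-- `QAP_d` is translation invariant. [cite: Grynkiewicz2009, §2] -/
theorem isQuasiProgression_vadd_iff {d a : G} {P : Finset G} :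
    IsQuasiProgression d (a +ᵥ P) ↔ IsQuasiProgression d P := by
  rw [IsQuasiProgression, IsQuasiProgression, componentCount_vadd]

/-- `QAP_d` is invariant under `P ↦ −P`. [cite: Grynkiewicz2009, §2] -/
theorem isQuasiProgression_neg_iff {d : G} {P : Finset G} :
    IsQuasiProgression d (-P) ↔ IsQuasiProgression d P := by
  rw [IsQuasiProgression, IsQuasiProgression, componentCount_neg]

/-- In a finite group `QAP_d` is invariant under complementation. [cite: Grynkiewicz2009, Lemma 5.8
(h_d(A+B) = 0 "whence h_d(overline{A+B}) = 0 as well")] -/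
theorem isQuasiProgression_compl_iff [Fintype G] {d : G} {P : Finset G} :
    IsQuasiProgression d Pᶜ ↔ IsQuasiProgression d P := by
  rw [IsQuasiProgression, IsQuasiProgression, componentCount_compl]

/-- A genuine arithmetic progression `{s, s + d, …, s + (ℓ−1) d}` (`ℓ ≥ 1`) which does not fill its
`⟨d⟩`-coset (`{s, …, s + ℓ d}` still has `ℓ + 1` distinct terms) is a quasi-progression with
difference `d`. [cite: Grynkiewicz2009, §2 (QAP_d ⊇ AP_d for aperiodic progressions)] -/
theorem isQuasiProgression_apFinset {s d : G} {ℓ : ℕ} (hℓ : 1 ≤ ℓ)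
    (hcard : #(apFinset s d (ℓ + 1)) = ℓ + 1) : IsQuasiProgression d (apFinset s d ℓ) := by
  unfold IsQuasiProgression componentCount
  rw [add_pair_zero_eq_union, ← apFinset_succ_eq_union s d hℓ, hcard]
  have h1 : #(apFinset s d ℓ) ≤ ℓ := card_apFinset_le s d ℓ
  have h2 : ℓ + 1 ≤ #(apFinset s d ℓ) + 1 := by
    rw [← hcard, apFinset_add_eq_union s d ℓ 1, apFinset_one]
    exact (card_union_le _ _).trans (by rw [card_singleton])
  omega

/-- A `d`-invariant finset is `⟨d⟩`-periodic in the sense of `IsPeriodicWith`.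
[cite: Grynkiewicz2009, §2 (quasi-periodic decomposition with quasi-period ⟨d⟩)] -/
theorem isPeriodicWith_zmultiples_of_vadd_eq {d : G} {P : Finset G} (h : d +ᵥ P = P) :
    IsPeriodicWith (AddSubgroup.zmultiples d) P := by
  intro x hx
  rw [AddSubgroup.zmultiples_eq_closure] at hx
  refine AddSubgroup.closure_induction (p := fun x _ => x +ᵥ P = P) ?_ ?_ ?_ ?_ hx
  · intro y hy
    rw [Set.mem_singleton_iff] at hy
    rw [hy, h]
  · exact zero_vadd G P
  · intro y z _ _ hy hz
    rw [add_vadd, hz, hy]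
  · intro y _ hy
    calc -y +ᵥ P = -y +ᵥ (y +ᵥ P) := by rw [hy]
      _ = P := neg_vadd_vadd y P

/-- **The arXiv wording of «quasi-progression», recovered (finite `G`)**: a quasi-progression `P`
with difference `d` has a quasi-periodic decomposition `P = P₁ ⊔ P₀` with quasi-period `⟨d⟩` whose
aperiodic part `P₀ ≠ ∅` is an arithmetic progression with difference `d` (Hamidoune's Lemma 6.1
with one run-end, `Isoperimetric.exists_eq_filter_union_apFinset_of_card_vadd_sdiff_eq_one`).
[cite: Grynkiewicz2009, §2] -/
theorem IsQuasiProgression.exists_isQuasiPeriodicDecomp [Fintype G] {d : G} {P : Finset G}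
    (hP : IsQuasiProgression d P) :
    ∃ P₁ P₀ : Finset G, IsQuasiPeriodicDecomp (AddSubgroup.zmultiples d) P P₁ P₀ ∧
      IsAP P₀ d ∧ P₀.Nonempty := by
  have hd := hP.ne_zero
  rw [IsQuasiProgression, componentCount_eq_card_vadd_sdiff] at hP
  obtain ⟨s, -, ℓ, hℓ, hPeq, hP₁, hcard, hdisj⟩ :=
    Isoperimetric.exists_eq_filter_union_apFinset_of_card_vadd_sdiff_eq_one hP
  set P₁ := P.filter fun x => x +ᵥ apFinset (0 : G) d (addOrderOf d) ⊆ P with hP₁def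
  refine ⟨P₁, apFinset s d ℓ, ⟨?_, ?_, hPeq.symm, ?_, ?_⟩, ⟨s, by rw [hcard]⟩,
    apFinset_nonempty s d hℓ⟩
  · rwa [Ne, AddSubgroup.zmultiples_eq_bot]
  · exact disjoint_right.2 fun x hx => hdisj x hx
  · exact isPeriodicWith_zmultiples_of_vadd_eq hP₁
  · intro x hx y hy
    rw [mem_apFinset] at hx hy
    obtain ⟨i, -, rfl⟩ := hx
    obtain ⟨j, -, rfl⟩ := hy
    rw [add_sub_add_left_eq_sub]
    exact AddSubgroup.sub_mem _ (AddSubgroup.nsmul_mem _ (AddSubgroup.mem_zmultiples d) _)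
      (AddSubgroup.nsmul_mem _ (AddSubgroup.mem_zmultiples d) _)

/-! ### The distance `d⊆(A, 𝒮)` -/

section SubsetDist

variable {α : Type*} [DecidableEq α]

/-- **`d⊆(A, 𝒮)`** for a finset `A` and a family `𝒮` of finsets.  Print: "For a set `𝒮` of subsets
of `G`, define `d⊆(A, 𝒮) = min_{B ∈ 𝒮} d⊆(A, B)`, where `d⊆(A, B) = |B ∖ A|`, if `A ⊆ B`, and
`d⊆(A, B) = ∞` otherwise.  Hence `d⊆(A, 𝒮)` measures how far away as a subset the set `A` is from
the sets `B ∈ 𝒮`."  Valued in `ℕ∞`; the inner infimum over the (empty or one-point) condition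
`A ⊆ B` is `|B ∖ A|` or `⊤ = ∞`. [cite: Grynkiewicz2009, §1] -/
noncomputable def subsetDist (A : Finset α) (𝒮 : Set (Finset α)) : ℕ∞ :=
  ⨅ B ∈ 𝒮, ⨅ (_ : A ⊆ B), ((#(B \ A) : ℕ) : ℕ∞)

omit [AddCommGroup G] [DecidableEq G] in
/-- `d⊆(A, 𝒮) ≤ |B ∖ A|` for every `B ∈ 𝒮` containing `A`. [cite: Grynkiewicz2009, §1] -/
theorem subsetDist_le {A B : Finset α} {𝒮 : Set (Finset α)} (hB : B ∈ 𝒮) (hAB : A ⊆ B) :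
    subsetDist A 𝒮 ≤ #(B \ A) := by
  unfold subsetDist
  exact (iInf₂_le B hB).trans (iInf_le _ hAB)

omit [AddCommGroup G] [DecidableEq G] in
/-- `k ≤ d⊆(A, 𝒮)` once `k ≤ |B ∖ A|` for every `B ∈ 𝒮` containing `A`.
[cite: Grynkiewicz2009, §1] -/
theorem le_subsetDist {A : Finset α} {𝒮 : Set (Finset α)} {k : ℕ∞}
    (h : ∀ B ∈ 𝒮, A ⊆ B → k ≤ #(B \ A)) : k ≤ subsetDist A 𝒮 := by
  unfold subsetDist
  exact le_iInf₂ fun B hB => le_iInf fun hAB => h B hB hAB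

omit [AddCommGroup G] [DecidableEq G] in
/-- `d⊆(A, 𝒮) = 0 ↔ A ∈ 𝒮`. [cite: Grynkiewicz2009, §1] -/
theorem subsetDist_eq_zero_iff {A : Finset α} {𝒮 : Set (Finset α)} :
    subsetDist A 𝒮 = 0 ↔ A ∈ 𝒮 := by
  constructor
  · intro h
    by_contra hA
    have h1 : (1 : ℕ∞) ≤ subsetDist A 𝒮 := le_subsetDist fun B hB hAB => by
      have hne : (B \ A).Nonempty := by
        rw [nonempty_iff_ne_empty, Ne, sdiff_eq_empty_iff_subset]
        exact fun hBA => hA (Subset.antisymm hBA hAB ▸ hB)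
      exact_mod_cast card_pos.2 hne
    rw [h] at h1
    exact absurd h1 (by norm_num)
  · intro hA
    exact nonpos_iff_eq_zero.1 ((subsetDist_le hA Subset.rfl).trans (le_of_eq (by simp)))

omit [AddCommGroup G] [DecidableEq G] in
/-- `d⊆(A, 𝒮) = 1` when `A ∉ 𝒮` but `A ∪ {β} ∈ 𝒮` for some `β ∉ A`. [cite: Grynkiewicz2009, §1] -/
theorem subsetDist_eq_one {A : Finset α} {𝒮 : Set (Finset α)} (hA : A ∉ 𝒮) {β : α} (hβ : β ∉ A)
    (hins : insert β A ∈ 𝒮) : subsetDist A 𝒮 = 1 := by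
  refine le_antisymm ?_ (le_subsetDist fun B hB hAB => ?_)
  · have := subsetDist_le hins (subset_insert β A)
    rwa [insert_sdiff_cancel hβ, card_singleton, Nat.cast_one] at this
  · have hne : (B \ A).Nonempty := by
      rw [nonempty_iff_ne_empty, Ne, sdiff_eq_empty_iff_subset]
      exact fun hBA => hA (Subset.antisymm hBA hAB ▸ hB)
    exact_mod_cast card_pos.2 hne

omit [AddCommGroup G] [DecidableEq G] in
/-- `d⊆(A, 𝒮) = ∞` when no member of `𝒮` contains `A` ("`d⊆(A, B) = ∞` otherwise").
[cite: Grynkiewicz2009, §1] -/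
theorem subsetDist_eq_top {A : Finset α} {𝒮 : Set (Finset α)} (h : ∀ B ∈ 𝒮, ¬ A ⊆ B) :
    subsetDist A 𝒮 = ⊤ := by
  unfold subsetDist
  exact iInf₂_eq_top.2 fun B hB => iInf_eq_top.2 fun hAB => absurd hAB (h B hB)

end SubsetDist

/-! ### Lemma 5.8 -/

namespace Grynkiewicz2009

/-- The arithmetic of the proof of Lemma 5.8: a non-increasing sequence `c` with `c_j ≥ 1 (j ≤ n)`,
`n ≥ 2` and `Σ_{j<n} c_j = n + 1` has `c_0 = 2` and `c_j = 1` for `1 ≤ j ≤ n` ("either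
`|A + B| ≥ |B| + 2(|A| − 1)` or else `|A + B| = |B| + |A| − 1 + d⊆(B, QAP_d)`.  Since `|A| ≥ 3`, and
since `|A + B| = |A| + |B|`, it follows that the former cannot hold").
[cite: Grynkiewicz2009, Lemma 5.8 (proof)] -/
theorem antitone_sum_eq {c : ℕ → ℕ} {n : ℕ} (hn : 2 ≤ n) (hsucc : ∀ j, c (j + 1) ≤ c j)
    (hpos : ∀ j ≤ n, 1 ≤ c j) (hsum : ∑ j ∈ range n, c j = n + 1) :
    c 0 = 2 ∧ ∀ j, 1 ≤ j → j ≤ n → c j = 1 := by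
  obtain ⟨m, rfl⟩ : ∃ m, n = m + 2 := ⟨n - 2, by omega⟩
  have hanti : Antitone c := antitone_nat_of_succ_le hsucc
  have hsum' : c 0 + c 1 + ∑ j ∈ range m, c (j + 2) = m + 3 := by
    have h := hsum
    rw [sum_range_succ', sum_range_succ'] at h
    have h22 : ∀ j, c (j + 1 + 1) = c (j + 2) := fun j => rfl
    simp only [h22, zero_add] at h
    omega
  have hlow : m ≤ ∑ j ∈ range m, c (j + 2) := by
    have := Finset.card_nsmul_le_sum (range m) (fun j => c (j + 2)) 1
      (fun j hj => hpos _ (by rw [mem_range] at hj; omega))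
    rw [card_range, smul_eq_mul, mul_one] at this
    exact this
  have hc1 : c 1 = 1 := by
    have h1 := hpos 1 (by omega)
    have h01 : c 1 ≤ c 0 := hsucc 0
    omega
  have hup : ∑ j ∈ range m, c (j + 2) ≤ m := by
    have := Finset.sum_le_card_nsmul (range m) (fun j => c (j + 2)) 1
      (fun j _ => by have := hanti (show 1 ≤ j + 2 by omega); rwa [hc1] at this)
    rw [card_range, smul_eq_mul, mul_one] at this
    exact this
  refine ⟨by omega, fun j hj1 hj2 => le_antisymm ?_ (hpos j hj2)⟩
  have := hanti hj1
  rwa [hc1] at this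

/-- **Lemma 5.8, quantitative core.**  If `|A + B| = |A| + |B|`, `|A| ≥ 3`, `A + B` is aperiodic and
`A` is an arithmetic progression with difference `d`, then `B` has exactly two aperiodic
`d`-components, `B + {0, d}` exactly one, and `A + B` exactly one (`c_d(B) = 2`,
`c_d(B + {0,d}) = 1`, `c_d(A + B) = 1`) — the content of "`|A + B| ≥ |B| + c(|A| − 1)` … the former
cannot hold, whence … `d⊆(B, QAP_d) = 1`.  Hence, since `|A| ≥ 3`, it follows that
`d⊆(A + B, QAP_d) = 0`".  Any abelian group. [cite: Grynkiewicz2009, Lemma 5.8] -/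
theorem componentCount_of_isAP {A B : Finset G} {d : G} (hAB : #(A + B) = #A + #B)
    (hA3 : 3 ≤ #A) (haper : (A + B).addStab = {0}) (hA : IsAP A d) :
    componentCount d B = 2 ∧ componentCount d (B + {0, d}) = 1 ∧
      componentCount d (A + B) = 1 := by
  obtain ⟨a₀, hAeq⟩ := hA
  have hd : d ≠ 0 := IsAP.ne_zero ⟨a₀, hAeq⟩ (by omega)
  set l := #A with hl
  set X : ℕ → Finset G := fun j => B + apFinset (0 : G) d (j + 1) with hX
  have hX0 : X 0 = B := add_apFinset_zero_one B d
  have hXsucc : ∀ j, X (j + 1) = X j + {0, d} := fun j => add_apFinset_zero_succ_succ B d j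
  have hAB' : A + B = a₀ +ᵥ X (l - 1) := by
    show A + B = a₀ +ᵥ (B + apFinset 0 d (l - 1 + 1))
    rw [Nat.sub_add_cancel (by omega), hAeq,
      show apFinset a₀ d l = a₀ +ᵥ apFinset 0 d l by rw [vadd_apFinset, add_zero], vadd_add_assoc,
      add_comm]
  have hcardX : ∀ m, #(X m) = #B + ∑ j ∈ range m, componentCount d (X j) := fun m =>
    card_add_apFinset_zero_eq B d m
  have hsucc : ∀ j, componentCount d (X (j + 1)) ≤ componentCount d (X j) := fun j => by
    rw [hXsucc]; exact componentCount_add_pair_zero_le d (X j)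
  have hinv : ∀ j, d +ᵥ X j = X j → ∀ i, X (j + i) = X j := by
    intro j hj i
    induction i with
    | zero => rfl
    | succ i ih => rw [← add_assoc, hXsucc, ih, add_pair_zero_eq_self_of_vadd_eq hj]
  have hne : (A + B).Nonempty := by rw [← card_pos]; omega
  have hpos : ∀ j ≤ l - 1, 1 ≤ componentCount d (X j) := by
    intro j hj
    by_contra h0
    have hz : d +ᵥ X j = X j := componentCount_eq_zero_iff.1 (by omega)
    have hXl : X (l - 1) = X j := by
      have := hinv j hz (l - 1 - j); rwa [Nat.add_sub_cancel' hj] at this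
    have hper : d +ᵥ (A + B) = A + B := by
      rw [hAB', hXl, vadd_vadd, add_comm d a₀, ← vadd_vadd, hz]
    have : d ∈ (A + B).addStab := (mem_addStab hne).2 hper
    rw [haper, mem_singleton] at this
    exact hd this
  have hsum : ∑ j ∈ range (l - 1), componentCount d (X j) = (l - 1) + 1 := by
    have h1 := hcardX (l - 1)
    have h2 : #(A + B) = #(X (l - 1)) := by rw [hAB', card_vadd_finset]
    omega
  obtain ⟨hc0, hcj⟩ :=
    antitone_sum_eq (c := fun j => componentCount d (X j)) (by omega) hsucc hpos hsum
  refine ⟨by rwa [hX0] at hc0, ?_, ?_⟩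
  · have := hcj 1 le_rfl (by omega)
    rwa [show X 1 = X 0 + {0, d} from hXsucc 0, hX0] at this
  · have := hcj (l - 1) (by omega) le_rfl
    rwa [hAB', componentCount_vadd]

/-- **Grynkiewicz 2009, Lemma 5.8** (arXiv:0710.1041v2 Lemma 4.12).  "Let `A` and `B` be finite,
nonempty subsets of an abelian group `G` with `|A + B| = |A| + |B|`, `|A| ≥ 3`, and `A + B`
aperiodic.  If `A` is an arithmetic progression with difference `d`, then `d⊆(B, QAP_d) = 1`,
`d⊆(A + B, QAP_d) = d⊆(overline{A + B}, QAP_d) = 0` and (17) holds", (17) being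
"`|(A ∪ {α}) + (B ∪ {β})| = |A ∪ {α}| + |B ∪ {β}| − 1` for some `α, β ∈ G`".  This theorem: the
conclusions about `B`, `A + B` and (17), in any abelian group; the complement clause (finite `G`)
is `subsetDist_quasiProgression_compl_of_isAP`.  Proof as printed, see the module docstring; (17)
holds with `α ∈ A` and `β` the single short hole of `B`. [cite: Grynkiewicz2009, Lemma 5.8] -/
theorem subsetDist_quasiProgression_of_isAP {A B : Finset G} {d : G} (hAB : #(A + B) = #A + #B)
    (hA3 : 3 ≤ #A) (haper : (A + B).addStab = {0}) (hA : IsAP A d) :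
    subsetDist B {P | IsQuasiProgression d P} = 1 ∧
      subsetDist (A + B) {P | IsQuasiProgression d P} = 0 ∧
      ∃ α β : G, #(insert α A + insert β B) + 1 = #(insert α A) + #(insert β B) := by
  obtain ⟨h2, h1, hAB1⟩ := componentCount_of_isAP hAB hA3 haper hA
  obtain ⟨β, hβB, hβ1, hβ2⟩ := exists_gap_one h2 h1
  have hins : componentCount d (insert β B) = 1 := by
    have := componentCount_insert_add_one hβB hβ1 hβ2; omega
  refine ⟨subsetDist_eq_one (by simp [IsQuasiProgression, h2]) hβB hins,
    subsetDist_eq_zero_iff.2 hAB1, ?_⟩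
  obtain ⟨a₀, hAeq⟩ := hA
  have ha₀ : a₀ ∈ A := by
    rw [hAeq, mem_apFinset]; exact ⟨0, by omega, by rw [zero_nsmul, add_zero]⟩
  have hAins : A + insert β B = A + B := by
    rw [hAeq]
    exact apFinset_add_insert_eq (by omega) hβ1 hβ2
  refine ⟨a₀, β, ?_⟩
  rw [insert_eq_of_mem ha₀, card_insert_of_notMem hβB, hAins, hAB]
  omega

/-- **Grynkiewicz 2009, Lemma 5.8, the complement clause** (finite `G`): under the hypotheses of
`subsetDist_quasiProgression_of_isAP`, also `d⊆(overline{A + B}, QAP_d) = 0`, i.e. `G ∖ (A + B)`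
is a quasi-progression with difference `d` ("whence `h_d(overline{A + B}) = 0` as well").
[cite: Grynkiewicz2009, Lemma 5.8] -/
theorem subsetDist_quasiProgression_compl_of_isAP [Fintype G] {A B : Finset G} {d : G}
    (hAB : #(A + B) = #A + #B) (hA3 : 3 ≤ #A) (haper : (A + B).addStab = {0}) (hA : IsAP A d) :
    subsetDist (A + B)ᶜ {P | IsQuasiProgression d P} = 0 := by
  obtain ⟨-, -, hAB1⟩ := componentCount_of_isAP hAB hA3 haper hA
  exact subsetDist_eq_zero_iff.2 (isQuasiProgression_compl_iff.2 hAB1)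

end Grynkiewicz2009

/-! ### Periodic sets `P`, the families `P_H`, `QP`, and their distances -/

/-- **Periodic set.**  Print: "If `A` is `H`-periodic with `H` a nontrivial subgroup, then `A` is
*periodic*, and otherwise `A` is aperiodic" — some nontrivial subgroup all of whose elements are periods
of `A`.  (The empty finset is periodic in this sense as soon as `G` is nontrivial,
`IsPeriodic.empty`; on nonempty finsets this is `A.addStab ≠ {0}`, `isPeriodic_iff_addStab_ne`.)
[cite: Grynkiewicz2009, §2] -/
def IsPeriodic (A : Finset G) : Prop := ∃ H : AddSubgroup G, H ≠ ⊥ ∧ IsPeriodicWith H A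

/-- In a nontrivial group the empty finset is (vacuously) periodic. [cite: Grynkiewicz2009, §2] -/
theorem IsPeriodic.empty [Nontrivial G] : IsPeriodic (∅ : Finset G) :=
  ⟨⊤, by simp, IsPeriodicWith.empty ⊤⟩

/-- For nonempty `A`: periodic iff the stabilizer `H(A)` is not `{0}` ("the maximal subgroup for which
`A` is periodic is the stabilizer of `A`, denoted `H(A) = {g ∈ G | g + A = A}`"; the tree spells
«aperiodic» as `A.addStab = {0}`). [cite: Grynkiewicz2009, §2] -/
theorem isPeriodic_iff_addStab_ne {A : Finset G} (hA : A.Nonempty) :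
    IsPeriodic A ↔ A.addStab ≠ {0} := by
  constructor
  · rintro ⟨H, hH, hper⟩
    exact hper.addStab_ne_singleton_zero hA hH
  · intro hne
    have h0 : (0 : G) ∈ A.addStab := hA.zero_mem_addStab
    obtain ⟨g, hg, hg0⟩ : ∃ g ∈ A.addStab, g ≠ 0 := by
      by_contra h
      push Not at h
      apply hne
      exact Subset.antisymm (fun x hx => mem_singleton.2 (h x hx)) (singleton_subset_iff.2 h0)
    refine ⟨AddAction.stabilizer G A, ?_, fun h hh => AddAction.mem_stabilizer_iff.1 hh⟩
    intro hbot
    have : g ∈ AddAction.stabilizer G A := by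
      rw [AddAction.mem_stabilizer_iff]; exact (mem_addStab hA).1 hg
    rw [hbot] at this
    exact hg0 (AddSubgroup.mem_bot.1 this)

/-- "Note that `P ⊆ QP`": a nonempty periodic set is quasi-periodic (decomposition `A = A ⊔ ∅`).
[cite: Grynkiewicz2009, §2] -/
theorem IsPeriodic.isQuasiPeriodic {A : Finset G} (h : IsPeriodic A) (hA : A.Nonempty) :
    IsQuasiPeriodic A := by
  obtain ⟨H, hH, hper⟩ := h
  exact hper.isQuasiPeriodic hA hH

/-- Periodicity is translation invariant. [cite: Grynkiewicz2009, §2] -/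
theorem IsPeriodic.vadd {A : Finset G} (h : IsPeriodic A) (g : G) : IsPeriodic (g +ᵥ A) := by
  obtain ⟨H, hH, hper⟩ := h
  exact ⟨H, hH, hper.vadd g⟩

section SubsetDistMono

variable {α : Type*} [DecidableEq α]

omit [AddCommGroup G] [DecidableEq G] in
/-- `d⊆(A, ·)` is antitone in the family: if every member of `𝒮` containing `A` lies in `𝒯`, then
`d⊆(A, 𝒯) ≤ d⊆(A, 𝒮)` (e.g. "`P ⊆ QP`" gives `d⊆(A, QP) ≤ d⊆(A, P)`). [cite: Grynkiewicz2009, §1] -/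
theorem subsetDist_anti {A : Finset α} {𝒮 𝒯 : Set (Finset α)}
    (h : ∀ P, A ⊆ P → P ∈ 𝒮 → P ∈ 𝒯) : subsetDist A 𝒯 ≤ subsetDist A 𝒮 :=
  le_subsetDist fun B hB hAB => subsetDist_le (h B hAB hB) hAB

omit [AddCommGroup G] [DecidableEq G] in
/-- `k ≤ d⊆(A, 𝒮)` iff `k ≤ |B ∖ A|` for every `B ∈ 𝒮` containing `A`. [cite: Grynkiewicz2009, §1] -/
theorem le_subsetDist_iff {A : Finset α} {𝒮 : Set (Finset α)} {k : ℕ∞} :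
    k ≤ subsetDist A 𝒮 ↔ ∀ B ∈ 𝒮, A ⊆ B → k ≤ #(B \ A) :=
  ⟨fun h _ hB hAB => h.trans (subsetDist_le hB hAB), le_subsetDist⟩

end SubsetDistMono

/-- `d⊆(A, QP) ≤ d⊆(A, P)` for nonempty `A` ("Note that `P ⊆ QP`"). [cite: Grynkiewicz2009, §2] -/
theorem subsetDist_isQuasiPeriodic_le {A : Finset G} (hA : A.Nonempty) :
    subsetDist A {P | IsQuasiPeriodic P} ≤ subsetDist A {P | IsPeriodic P} :=
  subsetDist_anti fun _ hAP hP => IsPeriodic.isQuasiPeriodic hP (hA.mono hAP)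

/-- A finset `Hf` carrying the subgroup `H` is invariant under the elements of `H` (subgroups as
finsets, in the tree's `(Hf, hHf)` convention of `HamidouneRodsethAbelianPairs.lean`).
[cite: Grynkiewicz2009, §2 (A + H = A for H-periodic A)] -/
theorem vadd_finset_eq_of_forall_mem_iff {H : AddSubgroup G} {Hf : Finset G}
    (hHf : ∀ g, g ∈ Hf ↔ g ∈ H) {h : G} (hh : h ∈ H) : h +ᵥ Hf = Hf := by
  refine eq_of_subset_of_card_le (fun x hx => ?_) (by rw [card_vadd_finset])
  obtain ⟨y, hy, rfl⟩ := mem_vadd_finset.1 hx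
  exact (hHf _).2 (H.add_mem hh ((hHf y).1 hy))

/-- `A + H` is `H`-periodic ("Hence if `A` is `H`-periodic, then so is `A + B`", with the roles of
`A = H` as a finset). [cite: Grynkiewicz2009, §2] -/
theorem isPeriodicWith_add_of_forall_mem_iff {H : AddSubgroup G} {Hf : Finset G}
    (hHf : ∀ g, g ∈ Hf ↔ g ∈ H) (A : Finset G) : IsPeriodicWith H (A + Hf) := by
  intro h hh
  rw [add_comm A Hf, ← vadd_add_assoc, vadd_finset_eq_of_forall_mem_iff hHf hh]

/-- "Note that `A` being `H`-periodic is equivalent to `A + H = A`" (with `H` carried as a finset).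
[cite: Grynkiewicz2009, §2] -/
theorem isPeriodicWith_iff_add_eq {H : AddSubgroup G} {Hf : Finset G}
    (hHf : ∀ g, g ∈ Hf ↔ g ∈ H) {A : Finset G} : IsPeriodicWith H A ↔ A + Hf = A := by
  have h0 : (0 : G) ∈ Hf := (hHf 0).2 H.zero_mem
  constructor
  · intro h
    refine Subset.antisymm ?_ (subset_add_left A h0)
    intro x hx
    obtain ⟨a, ha, f, hf, rfl⟩ := mem_add.1 hx
    rw [← h f ((hHf f).1 hf), add_comm]
    exact mem_vadd_finset.2 ⟨a, ha, rfl⟩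
  · intro h
    rw [← h]
    exact isPeriodicWith_add_of_forall_mem_iff hHf A

/-- **`d⊆(A, P_H) = |A + H| − |A|`, the number of `H`-holes of `A`** ("An `H`-hole in `A` is an element
of `(A + H) ∖ A`"; `P_H` = the `H`-periodic sets; `ρ = |A + H| − |A| + |B + H| − |B| =
d⊆(A, A + H) + d⊆(B, B + H)` on print p. 3): the least `H`-periodic superset of `A` is `A + H`.
`H` is carried as a finset `Hf`. [cite: Grynkiewicz2009, §2] -/
theorem subsetDist_isPeriodicWith {H : AddSubgroup G} {Hf : Finset G}
    (hHf : ∀ g, g ∈ Hf ↔ g ∈ H) (A : Finset G) :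
    subsetDist A {P | IsPeriodicWith H P} = ((#(A + Hf) - #A : ℕ) : ℕ∞) := by
  have h0 : (0 : G) ∈ Hf := (hHf 0).2 H.zero_mem
  have hAsub : A ⊆ A + Hf := subset_add_left A h0
  have hper : IsPeriodicWith H (A + Hf) := isPeriodicWith_add_of_forall_mem_iff hHf A
  have hc : #((A + Hf) \ A) = #(A + Hf) - #A := by
    have := card_sdiff_add_card_eq_card hAsub; omega
  apply le_antisymm
  · calc subsetDist A {P | IsPeriodicWith H P} ≤ #((A + Hf) \ A) :=
          subsetDist_le (show A + Hf ∈ {P | IsPeriodicWith H P} from hper) hAsub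
      _ = _ := by rw [hc]
  · refine le_subsetDist fun B hB hAB => ?_
    have hB' : IsPeriodicWith H B := hB
    have hsub : A + Hf ⊆ B := by
      intro x hx
      obtain ⟨a, ha, f, hf, rfl⟩ := mem_add.1 hx
      have hfB : f +ᵥ B = B := hB' f ((hHf f).1 hf)
      rw [← hfB, add_comm]
      exact mem_vadd_finset.2 ⟨a, hAB ha, rfl⟩
    rw [← hc]
    exact_mod_cast card_le_card (sdiff_subset_sdiff hsub Subset.rfl)

/-- **The arXiv wording of «quasi-progression» implies the printed one**: if `P = P₁ ⊔ P₀` with `P₁`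
`d`-invariant (`⟨d⟩`-periodic or empty) and `P₀ = {s, s + d, …, s + (ℓ−1) d}` a nonempty arithmetic
progression that does not fill its `⟨d⟩`-coset (`{s, …, s + ℓ d}` still has `ℓ + 1` terms) and
whose coset `s + ⟨d⟩` misses `P₁`, then `c_d(P) = 1`.  Converse direction:
`IsQuasiProgression.exists_isQuasiPeriodicDecomp`. [cite: Grynkiewicz2009, §2] -/
theorem isQuasiProgression_union_apFinset {P₁ : Finset G} {d s : G} {ℓ : ℕ} (hP₁ : d +ᵥ P₁ = P₁)
    (hℓ : 1 ≤ ℓ) (hcard : #(apFinset s d (ℓ + 1)) = ℓ + 1) (hdisj : ∀ n : ℕ, s + n • d ∉ P₁) :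
    IsQuasiProgression d (P₁ ∪ apFinset s d ℓ) := by
  have hq := isQuasiProgression_apFinset hℓ hcard
  rw [IsQuasiProgression, componentCount_eq_card_vadd_sdiff] at hq ⊢
  rw [vadd_finset_union, hP₁]
  have : (P₁ ∪ (d +ᵥ apFinset s d ℓ)) \ (P₁ ∪ apFinset s d ℓ) =
      ((d +ᵥ apFinset s d ℓ) \ apFinset s d ℓ) \ P₁ := by
    ext x
    simp only [mem_sdiff, mem_union, not_or]
    tauto
  obtain ⟨e, he⟩ := card_eq_one.1 hq
  have heD : e ∈ (d +ᵥ apFinset s d ℓ) \ apFinset s d ℓ := by rw [he]; exact mem_singleton_self e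
  have heP : e ∉ P₁ := by
    obtain ⟨y, hy, rfl⟩ := mem_vadd_finset.1 (mem_sdiff.1 heD).1
    obtain ⟨i, -, rfl⟩ := mem_apFinset.1 hy
    have := hdisj (i + 1)
    rwa [succ_nsmul, ← add_assoc, add_comm _ d] at this
  rw [this, he, Finset.sdiff_eq_self_iff_disjoint.2 (disjoint_singleton_left.2 heP), card_singleton]

/-! ### Two printed remarks of §2: punctured periodic sets; a lone element in an `H(A+B)`-coset -/

/-- If `A ∪ {γ}` (`γ ∉ A`) is `H`-periodic for a nontrivial `H`, then every period of `A` is `0`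
("A punctured periodic set is a set `A` such that `A ∪ {γ}` is periodic for some `γ ∉ A` … We remark
that a punctured periodic set cannot be periodic (as for instance shown in [10] [11])": take
`0 ≠ h ∈ H`; `γ + h ∈ A`, so `g + γ + h ∈ A` and, by `(−h)`-periodicity of `A ∪ {γ}`, `g + γ ∈ A ∪ {γ}`;
`g + γ ∈ A` would put `γ ∈ −g + A = A`). [cite: Grynkiewicz2009, §2] -/
theorem eq_zero_of_vadd_eq_of_isPeriodicWith_insert {H : AddSubgroup G} {A : Finset G} {γ : G}
    (hH : H ≠ ⊥) (hγ : γ ∉ A) (hP : IsPeriodicWith H (insert γ A)) {g : G} (hg : g +ᵥ A = A) :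
    g = 0 := by
  obtain ⟨h, hhH, hh0⟩ : ∃ h ∈ H, h ≠ (0 : G) := by
    by_contra hne
    push Not at hne
    exact hH ((AddSubgroup.eq_bot_iff_forall _).2 hne)
  set P := insert γ A with hPdef
  have hγP : γ ∈ P := mem_insert_self γ A
  have hγh : γ + h ∈ A := by
    have : γ + h ∈ P := by
      rw [← hP h hhH, add_comm]; exact mem_vadd_finset.2 ⟨γ, hγP, rfl⟩
    rw [hPdef, mem_insert] at this
    rcases this with h1 | h1
    · exact absurd (by simpa using h1) hh0
    · exact h1
  have h1 : g + (γ + h) ∈ A := by rw [← hg]; exact mem_vadd_finset.2 ⟨γ + h, hγh, rfl⟩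
  have h2 : g + γ ∈ P := by
    have hneg : -h ∈ H := H.neg_mem hhH
    rw [← hP (-h) hneg]
    refine mem_vadd_finset.2 ⟨g + (γ + h), mem_insert_of_mem h1, ?_⟩
    rw [vadd_eq_add]; abel
  rw [hPdef, mem_insert] at h2
  rcases h2 with h2 | h2
  · simpa using h2
  · exfalso
    apply hγ
    have hneg : -g +ᵥ A = A := by
      conv_lhs => rw [← hg]
      rw [neg_vadd_vadd]
    rw [← hneg]
    exact mem_vadd_finset.2 ⟨g + γ, h2, by rw [vadd_eq_add]; abel⟩

/-- **"A punctured periodic set cannot be periodic"** (print p. 3, citing [10] [11] = Grynkiewicz 2005):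
if `A ≠ ∅`, `γ ∉ A` and `A ∪ {γ}` is `H`-periodic with `H` nontrivial, then `A` is not periodic.
[cite: Grynkiewicz2009, §2] -/
theorem not_isPeriodic_of_isPeriodicWith_insert {H : AddSubgroup G} {A : Finset G} {γ : G}
    (hH : H ≠ ⊥) (hγ : γ ∉ A) (hP : IsPeriodicWith H (insert γ A)) (hA : A.Nonempty) :
    ¬ IsPeriodic A := by
  rw [isPeriodic_iff_addStab_ne hA, not_ne_iff]
  refine Subset.antisymm (fun g hg => mem_singleton.2 ?_)
    (singleton_subset_iff.2 hA.zero_mem_addStab)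
  exact eq_zero_of_vadd_eq_of_isPeriodicWith_insert hH hγ hP ((mem_addStab hA).1 hg)

/-- **"Consequently, if either `A` or `B` contains a unique element from some `H`-coset, then
`|A + B| ≥ |A| + |B| − 1`"** (`H = H(A + B)`; print p. 3, from Kneser's theorem
`|A + B| ≥ |A + H| + |B + H| − |H|`, the coset of the lone element `a` contributing `|H| − 1` holes):
here for `A`, the lone element being `a` (`x ∈ A`, `x − a ∈ H(A+B)` ⇒ `x = a`); `ℕ` form
`|A| + |B| ≤ |A + B| + 1`. [cite: Grynkiewicz2009, §2] -/
theorem card_add_card_le_card_add_succ_of_lone_coset {A B : Finset G} {a : G} (ha : a ∈ A)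
    (huniq : ∀ x ∈ A, x - a ∈ (A + B).addStab → x = a) (hB : B.Nonempty) :
    #A + #B ≤ #(A + B) + 1 := by
  set H := (A + B).addStab with hH
  have hA : A.Nonempty := ⟨a, ha⟩
  have hHne : H.Nonempty := (hA.add hB).addStab
  have h0H : (0 : G) ∈ H := (hA.add hB).zero_mem_addStab
  have kn := add_kneser (s := A) (t := B)
  rw [← hH] at kn
  have hsub : (A.erase a) ∪ (a +ᵥ H) ⊆ A + H := by
    intro x hx
    rw [mem_union] at hx
    rcases hx with hx | hx
    · exact mem_add.2 ⟨x, mem_of_mem_erase hx, 0, h0H, add_zero x⟩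
    · obtain ⟨h, hh, rfl⟩ := mem_vadd_finset.1 hx
      exact mem_add.2 ⟨a, ha, h, hh, rfl⟩
  have hdisj : Disjoint (A.erase a) (a +ᵥ H) := by
    rw [disjoint_left]
    intro x hx hx'
    rw [mem_erase] at hx
    obtain ⟨h, hh, rfl⟩ := mem_vadd_finset.1 hx'
    have := huniq _ hx.2 (by rwa [vadd_eq_add, add_sub_cancel_left])
    exact hx.1 this
  have hcard : #A - 1 + #H ≤ #(A + H) := by
    have := card_le_card hsub
    rw [card_union_of_disjoint hdisj, card_erase_of_mem ha, card_vadd_finset] at this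
    exact this
  have hBH : #B ≤ #(B + H) := card_le_card_add_right hHne
  have : 1 ≤ #A := hA.card_pos
  omega

end Literature.Combinatorics.Additive

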